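import Mathlib
import Literature.MathematicalPhysics.MHD.CerfonFreidbergSolutions
import Summits.Ventures.FusionMHD.Models.SolovevPCF
import HarnessLib

/-!
# Ventures/FusionMHD — Models/CerfonFreidbergIterLike.lean: the Cerfon–Freidberg «ITER-like» instance OF RECORD for F2 step 2b,
# as a typed predicate (α = 0, shape triple (8/25, 17/10, 33/100), ERRATUM-corrected boundary fit)

HONEST FRAMING (LADDER-GRIDFUSION three columns). MODELLED: the ANALYTIC Cerfon–Freidberg equilibrium family
`U = U_P + Σ c_j U_j` (Freidberg 2014 (6.151)/(6.153); `Literature/…/CerfonFreidbergSolutions.lean`) with Solov'ev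
profiles, `α = 0` (the α OF RECORD, lead 2026-08-27T02:06:53Z), fitted to the printed ITER-like triple
`(ε, κ, δ) = (8/25, 17/10, 33/100)` of Pataki–Cerfon–Freidberg 2013 §6.1 by the seven constraints (6.155) WITH THE
BRACKET VALUES of (6.156) (`IsBoundaryFitGeom`, erratum p490998 / osculation theorems p494255) — «computed equilibrium
(CF profile)» in the F2 labels, NOT the polynomial PCF instance of `Models/SolovevPCF.lean`. CERTIFIED content (kernel,
this file): the defining predicate and what follows from it formally (every instance solves `Δ*U = X²` on `X > 0`).
NOT here: existence/uniqueness of the coefficient vector `c` — that is the certified 7×7 interval solve of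
gridfusion's lineage-1 truth file `bench/F2-CF-ITER-truth-lineage1.json` (c₀…c₆ with radii ≤ 7·10⁻¹¹⁴; lineage 2 =
ref-1), a CERTIFIED-interval statement outside the kernel; a kernel proof needs certified enclosures of `ln(17/25)`,
`ln(33/25)`, `ln(559/625)`, `arcsin(33/100)` and is open. Typer/prover: gridfusion-model-5 (g4), 2026-08-27.
Citations: Freidberg 2014 §6.6.1 (6.150)–(6.156) [Freidberg2014]; Pataki–Cerfon–Freidberg 2013 §6.1 [PatakiCerfonFreidberg2013].
-/

noncomputable section

namespace Summit.Ventures.FusionMHD.Models.CFIterLike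

open Literature.MathematicalPhysics.MHD Literature.MathematicalPhysics.MHD.GradShafranov
  Literature.MathematicalPhysics.MHD.CerfonFreidberg _root_.Real

/-- Inverse aspect ratio of the reference surface, `ε = 8/25` (PCF 2013 §6.1 «ITER-like»). -/
def ε : ℝ := 8 / 25
/-- Elongation of the reference surface, `κ = 17/10`. -/
def κ : ℝ := 17 / 10
/-- Triangularity of the reference surface, `δ = sin δ₀ = 33/100`. -/
def δ : ℝ := 33 / 100
/-- `δ₀ = arcsin δ` (transcendental; the curvature coefficients `N₁, N₂` of (6.156) are therefore not rational). -/
def δ₀ : ℝ := Real.arcsin δ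
/-- The Solov'ev mixing parameter OF RECORD, `α = 0` (`A = 0`: `Δ*U = X²`, the PCF profiles; lead 2026-08-27T02:06:53Z). -/
def α : ℝ := 0

/-- THE INSTANCE OF RECORD as a predicate on a flux function `U(X, Y)`: `U` is a member of the up–down symmetric
Cerfon–Freidberg family with `α = 0` for SOME coefficient vector `c : Fin 7 → ℝ`, and satisfies the seven boundary
constraints (6.155) on the ITER-like reference surface with the BRACKET curvature values (`IsBoundaryFitGeom`).
MODELLED: analytic CF equilibrium; the certified coefficients live in bench/F2-CF-ITER-truth-lineage1.json. -/
def IsInstance (U : ℝ → ℝ → ℝ) : Prop :=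
  (∃ c : Fin 7 → ℝ, U = cfSolution α c) ∧ IsBoundaryFitGeom ε κ δ₀ U

/-- Every instance solves the normalised Solov'ev equation with `α = 0`, i.e. `Δ*U = X²`, on `{X > 0}`. -/
theorem isNormalisedSolovevSolutionOn_of_isInstance {U : ℝ → ℝ → ℝ} (h : IsInstance U) :
    IsNormalisedSolovevSolutionOn {x : ℝ × ℝ | 0 < x.1} U α := by
  obtain ⟨⟨c, rfl⟩, -⟩ := h
  exact isNormalisedSolovevSolutionOn_cfSolution α c

/-- Concretely: `Δ*U = X²` at every point with `X > 0` (`α = 0`). -/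
theorem gsOperator_of_isInstance {U : ℝ → ℝ → ℝ} (h : IsInstance U) {X : ℝ} (Y : ℝ) (hX : 0 < X) :
    gsOperator U X Y = X ^ 2 := by
  have := isNormalisedSolovevSolutionOn_of_isInstance h X Y hX
  rw [this]
  unfold α
  ring

/-- Every instance vanishes at the three printed boundary points `(1 ± ε, 0)`, `(1 − δε, κε)` = `(33/25, 0)`,
`(17/25, 0)`, `(559/625, 68/125)` (constraints 1, 3, 5; `sin δ₀ = δ` since `|δ| ≤ 1`). -/
theorem zero_at_constraint_points {U : ℝ → ℝ → ℝ} (h : IsInstance U) :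
    U (33 / 25) 0 = 0 ∧ U (17 / 25) 0 = 0 ∧ U (559 / 625) (68 / 125) = 0 := by
  obtain ⟨-, h1, -, h3, -, h5, -, -⟩ := h
  have hs : Real.sin δ₀ = δ := by
    unfold δ₀
    exact Real.sin_arcsin (by unfold δ; norm_num) (by unfold δ; norm_num)
  rw [hs] at h5
  refine ⟨?_, ?_, ?_⟩
  · have e : (1 : ℝ) + ε = 33 / 25 := by unfold ε; norm_num
    rw [← e]; exact h1
  · have e : (1 : ℝ) - ε = 17 / 25 := by unfold ε; norm_num
    rw [← e]; exact h3
  · have e1 : (1 : ℝ) - δ * ε = 559 / 625 := by unfold δ ε; norm_num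
    have e2 : κ * ε = 68 / 125 := by unfold κ ε; norm_num
    rw [← e1, ← e2]; exact h5

/-- The equatorial curvature constraints an instance satisfies, in the typed closed forms: `U_YY = +N1·U_X` at the
outer point and `U_YY = +N2·U_X` at the inner point (the ERRATUM-corrected signs; `N1 > 0 > N2`). -/
theorem curvature_constraints {U : ℝ → ℝ → ℝ} (h : IsInstance U) :
    dZZ U (1 + ε) 0 = N1 ε κ δ₀ * dR U (1 + ε) 0 ∧ dZZ U (1 - ε) 0 = N2 ε κ δ₀ * dR U (1 - ε) 0 := by
  obtain ⟨-, -, h2, -, h4, -, -, -⟩ := h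
  exact ⟨h2, h4⟩

end Summit.Ventures.FusionMHD.Models.CFIterLike
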